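import Literature.AlgebraicGeometry.Motives.AlgebraicClassesKunnethFullyAlgebraicFactorFinrank
import Literature.AlgebraicGeometry.Motives.ZetaFunctionPoleOrderTateConjecture
import Literature.AlgebraicGeometry.Motives.FrobeniusCharpolyKunnethProducts
import HarnessLib

/-!
# One Galois element on `H^{2c}(X × Z)(c)` for a factor `Z` with fully algebraic cohomology:
# fixed classes `Ker(φ_c − 1) = ⊕ Ker(φ_p − 1) ⊗ H^{2q}(Z)`, the generalized eigenspace
# `H^{2c}(X × Z)(c)_1 = ⊕ H^{2p}(X)(p)_1 ⊗ H^{2q}(Z)`, the semisimplicity condition `S`, and the order of the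
# pole of `Z(X × Z, T)` at `T = q^{−c}`

Topic `Literature/AlgebraicGeometry/Motives`; THEOREMS ONLY (no definition, no instance, no named fact;
D-0026).

Rows g53-#1 … g53-#4 decomposed the algebraic classes and the `Γ_k`-invariants of `H^{2c}(X × Z)(c)` along the
Künneth isomorphism when `K·A^q(Z) = H^{2q}(Z)` for all `q` and `b_{odd}(Z) = 0`.  Over a finite field the
statements of Tate's theorem (Tate 1994 Th. 2.9; Milne 2007 Th. 1.2; Kahn 2020 §6.14 Th. 6.53) are about ONE
element, the Frobenius `φ`: the fixed space `Ker(φ_c − 1)` of the twisted Frobenius `φ_c = χ(φ)ᶜ φ` on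
`H^{2c}(c)` (Milne's `T′`-form of the Tate conjecture: `K·Aᶜ = Ker(φ_c − 1)`), its generalized eigenspace
`H^{2c}(c)_1` for the eigenvalue `1` (whose dimension is «the multiplicity of `qᶜ` as an inverse root of
`P_{2c}(X, t)`», the order of the pole of `Z(X, T)` at `q^{−c}`), and the semisimplicity condition `S`
(«`π` acts semisimply on `H^{2c}(c)_1`, i.e. as `1`»: `Ker(φ_c − 1) ∩ (φ_c − 1)H = 0`).  This file transports
all three through the Künneth decomposition, for an ARBITRARY `g ∈ Γ_k` over any field (§1–§3) and then for the
Frobenius over `𝔽_q` (§4):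

* §1 the Künneth components intertwine `g` on `H^{2c}(X × Z)(c)` with `g ⊗ 1` on `H^{2p}(X)(p) ⊗ H^{2q}(Z)`
  (`kunnethComponent_comp_ρTwist`, and with `(g − 1)^j` ↔ `(g − 1)^j ⊗ 1`:
  `kunnethComponent_ρTwist_sub_one_pow`);
* §2 **fixed classes**: `z` is fixed by `g` iff each `z_{2p,2q} ∈ Ker(g − 1 | H^{2p}(X)(p)) ⊗ H^{2q}(Z)`
  (`mem_ker_sub_one_tensor_iff`), component images (`map_kunnethComponent_ker_sub_one_tensor`),
  **`dim Ker(g − 1 | H^{2c}(X × Z)(c)) = Σ_{p+q=c} dim Ker(g − 1 | H^{2p}(X)(p)) · b_{2q}(Z)`**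
  (`finrank_ker_sub_one_tensor`);
* §3 **generalized eigenspace of `1`**: `mem_maxGenEigenspace_one_tensor_iff`,
  `map_kunnethComponent_maxGenEigenspace_one_tensor`, **`finrank_maxGenEigenspace_one_tensor`**
  (`dim H^{2c}(X × Z)(c)_1 = Σ_{p+q=c} dim H^{2p}(X)(p)_1 · b_{2q}(Z)`), and the semisimplicity condition:
  **`S` for `g` on `H^{2c}(X × Z)(c)` iff `S` for `g` on `H^{2p}(X)(p)` for every `p + q = c` with
  `H^{2q}(Z) ≠ 0`** (`ker_inf_range_eq_bot_tensor_iff`; Kahn Th. 6.54 ∕ Milne Th. 1.3 compare `X` and `X × X` —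
  here the second factor is of Tate type and `S` neither improves nor degrades);
* §4 `k` finite, `g = φ` the geometric Frobenius, `E` with the Lefschetz trace formula and `χ(φ_arith) = q`:
  granted the Riemann hypothesis for `X` and for `Z`, **the pole of `Z(X × Z, T)` at `T = q^{−c}` has order
  `Σ_{p+q=c} dim H^{2p}(X)(p)_1 · b_{2q}(Z)`** (`hasPoleOfOrderAt_zetaSeries_tensor_of_algebraic_cohomology`;
  row g52-#11 is the case `Z = 𝐏ⁿ`), i.e. `ord_{q^{−c}} Z(X × Z) = Σ_q b_{2q}(Z) · ord_{q^{−(c−q)}} Z(X)`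
  (`hasPoleOfOrderAt_zetaSeries_tensor_of_forall`).

HC is not touched.

## References

* [Tate1994] J. Tate, *Conjectures on algebraic cycles in ℓ-adic cohomology*, PSPM 55.1 (1994), §1, §2 Th. 2.9.
* [Milne2007TateFiniteFieldsAIM] J. S. Milne, *The Tate conjecture over finite fields (AIM talk)*,
  arXiv:0709.3040, §1 (Conjecture `S^r(X, ℓ)`, Th. 1.2, Th. 1.3 and its proof «Künneth formula»), §2 Cor. 2.2.
* [Milne1986ValuesZetaFunctionsFiniteFields] J. S. Milne, *Values of zeta functions of varieties over finite
  fields*, Amer. J. Math. 108 (1986), §8 (`T(X,r,ℓ)`, `T′`, `SS`, Prop. 8.2).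
* [Kahn2020] B. Kahn, *Zeta and L-Functions of Varieties and Motives* (2020), §3.6 axiom (vi), §6.14
  (`S^i`, `SS^i`, Conj. 6.52, Th. 6.53, Th. 6.54).
* [TateWoodsHole1965] J. Tate, *Algebraic cycles and poles of zeta functions* (1965), §3 (12)–(13).
* [Roman2008] S. Roman, *Advanced Linear Algebra* (2008), Ch. 14 Th. 14.5–14.6.
* Tree: rows g53-#1 … g53-#4; `ZetaFunctionPoleOrderTateConjecture` (`hasPoleOfOrderAt_zetaSeries`: the pole order
  is `dim H^{2r}(r)_1` under RH), `FrobeniusCharpolyKunnethProducts` (`weilRiemannHypothesisFor_tensor`),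
  `LinearAlgebra/InvariantPerfectPairingFixedSpaces` (`ker_inf_range_eq_bot_iff_maxGenEigenspace_eq`),
  `TateConjectureAlgebraicCohomology` (`ρTwist_eq_one_of_algebraicClasses_eq_top`).

## Provenance

Lane `lit-hodgefound` (summit `HodgeConjecture`, Track 2 foundations library, Layer B: motives ∕ Tate's
conjecture over finite fields), seat `lit-hodgefound-p29` (literature-prover, generation 53, row g53-#5).
-/

universe u v

open CategoryTheory AlgebraicGeometry MonoidalCategory CartesianMonoidalCategory
open Finset.HasAntidiagonal (antidiagonal mem_antidiagonal)
open scoped TensorProduct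

noncomputable section

/-! ### §0 Linear algebra: `f ⊗ 1` kills `U ⊗ S` when `f` kills `U` -/

namespace Literature.LinearAlgebra.TensorContraction

variable {K : Type*} [Field K] {V W : Type*} [AddCommGroup V] [Module K V] [AddCommGroup W] [Module K W]

/-- `f ⊗ 1` vanishes on `U ⊗ S` when `f` vanishes on `U`. [cite: Roman2008, Ch. 14 Th. 14.5] -/
theorem rTensor_eq_zero_of_mem_map₂ (f : V →ₗ[K] V) {U : Submodule K V} (hU : ∀ u ∈ U, f u = 0)
    (S : Submodule K W) {t : V ⊗[K] W} (ht : t ∈ Submodule.map₂ (TensorProduct.mk K V W) U S) :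
    LinearMap.rTensor W f t = 0 := by
  rw [Submodule.map₂_eq_span_image2] at ht
  induction ht using Submodule.span_induction with
  | mem x hx =>
    obtain ⟨v, hv, w, -, rfl⟩ := hx
    dsimp only
    rw [TensorProduct.mk_apply, LinearMap.rTensor_tmul, hU v hv, TensorProduct.zero_tmul]
  | zero => rw [map_zero]
  | add x y _ _ hx hy => rw [map_add, hx, hy, add_zero]
  | smul a x _ hx => rw [map_smul, hx, smul_zero]

end Literature.LinearAlgebra.TensorContraction

namespace Literature.AlgebraicGeometry.Motives

namespace GaloisWeilCohomology

open Literature.LinearAlgebra.TensorContraction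
open Literature.AlgebraicGeometry.Kahn2003 (HasPoleOfOrderAt)

variable {k : Type u} [Field k] {K : Type v} [Field K] [CharZero K]
  {χ : Field.absoluteGaloisGroup k →* Kˣ} (E : GaloisWeilCohomology k K χ)
variable {n m : ℕ} {X Z : SchemeOver k}

/-! ### §1 `g` on `H^{2c}(X × Z)(c)` versus `g ⊗ 1` on `H^{2p}(X)(p) ⊗ H^{2q}(Z)` -/

/-- **The `(2p, 2q)` Künneth component intertwines `g` on `H^{2c}(X × Z)(c)` with `g ⊗ 1`** when
`K·A^q(Z) = H^{2q}(Z)` (`Γ_k` acts trivially on `H^{2q}(Z)(q)`).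
[cite: Milne2007TateFiniteFieldsAIM, Th. 1.3 (proof: «Künneth formula»)] [cite: Tate1994, §1] -/
theorem kunnethComponent_comp_ρTwist (hX : IsSmoothProjective n X) (hZ : IsSmoothProjective m Z)
    {p q c : ℕ} (hpq : p + q = c) (hZq : E.algebraicClasses Z q = ⊤) (h : 2 * p + 2 * q = 2 * c)
    (g : Field.absoluteGaloisGroup k) :
    E.kunnethComponent hX hZ (2 * p) (2 * q) h ∘ₗ (E.ρTwist (X ⊗ Z) (2 * c) c g : _ →ₗ[K] _) =
      LinearMap.rTensor (E.obj Z (2 * q)) (E.ρTwist X (2 * p) p g) ∘ₗ E.kunnethComponent hX hZ (2 * p) (2 * q) h := by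
  refine LinearMap.ext fun z ↦ ?_
  rw [LinearMap.comp_apply, LinearMap.comp_apply, E.kunnethComponent_ρTwist_natCast hX hZ hpq h g z,
    E.ρTwist_eq_one_of_algebraicClasses_eq_top hZ hZq g, Module.End.one_eq_id]
  rfl

/-- The same with the unipotent parts: **`((g − 1)^j z)_{2p,2q} = ((g − 1)^j ⊗ 1)(z_{2p,2q})`.**
[cite: Milne2007TateFiniteFieldsAIM, Th. 1.3 (proof)] [cite: Kahn2020, §6.14 (S^i, SS^i)] -/
theorem kunnethComponent_ρTwist_sub_one_pow (hX : IsSmoothProjective n X) (hZ : IsSmoothProjective m Z)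
    {p q c : ℕ} (hpq : p + q = c) (hZq : E.algebraicClasses Z q = ⊤) (h : 2 * p + 2 * q = 2 * c)
    (g : Field.absoluteGaloisGroup k) (j : ℕ) (z : E.obj (X ⊗ Z) (2 * c)) :
    E.kunnethComponent hX hZ (2 * p) (2 * q) h (((E.ρTwist (X ⊗ Z) (2 * c) c g - 1) ^ j) z) =
      LinearMap.rTensor (E.obj Z (2 * q)) ((E.ρTwist X (2 * p) p g - 1) ^ j)
        (E.kunnethComponent hX hZ (2 * p) (2 * q) h z) := by
  induction j generalizing z with
  | zero => rw [pow_zero, pow_zero, Module.End.one_apply, Module.End.one_eq_id, LinearMap.rTensor_id,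
      LinearMap.id_apply]
  | succ j ih =>
    rw [pow_succ, Module.End.mul_apply, ih, pow_succ, LinearMap.rTensor_mul, Module.End.mul_apply,
      LinearMap.rTensor_sub, LinearMap.sub_apply, LinearMap.sub_apply, Module.End.one_apply,
      Module.End.one_eq_id, LinearMap.rTensor_id, LinearMap.id_apply, map_sub]
    congr 2
    exact LinearMap.congr_fun (E.kunnethComponent_comp_ρTwist hX hZ hpq hZq h g) z

/-! ### §2 Fixed classes: `Ker(g − 1 | H^{2c}(X × Z)(c)) = ⊕ Ker(g − 1 | H^{2p}(X)(p)) ⊗ H^{2q}(Z)` -/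

/-- **`z ∈ H^{2c}(X × Z)(c)` is fixed by `g` iff each Künneth component `z_{2p,2q}` lies in
`Ker(g − 1 | H^{2p}(X)(p)) ⊗ H^{2q}(Z)`**, for `Z` with `K·A^q(Z) = H^{2q}(Z)` for all `q` and `b_{odd}(Z) = 0`
(row g53-#2 did all of `Γ_k` at once; this is one element, e.g. a Frobenius).
[cite: Milne2007TateFiniteFieldsAIM, Th. 1.3 (proof) and Cor. 2.2 (proof)] [cite: Tate1994, §1]
[cite: Roman2008, Ch. 14 Th. 14.6 (3)] -/
theorem mem_ker_sub_one_tensor_iff (hX : IsSmoothProjective n X) (hZ : IsSmoothProjective m Z)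
    (hZalg : ∀ q, E.algebraicClasses Z q = ⊤) (hZodd : ∀ j, Odd j → Module.finrank K (E.obj Z j) = 0)
    (g : Field.absoluteGaloisGroup k) {c : ℕ} (z : E.obj (X ⊗ Z) (2 * c)) :
    z ∈ LinearMap.ker (E.ρTwist (X ⊗ Z) (2 * c) c g - 1) ↔
      ∀ (p q : ℕ) (h : 2 * p + 2 * q = 2 * c), E.kunnethComponent hX hZ (2 * p) (2 * q) h z ∈
        Submodule.map₂ (TensorProduct.mk K (E.obj X (2 * p)) (E.obj Z (2 * q)))
          (LinearMap.ker (E.ρTwist X (2 * p) p g - 1)) ⊤ := by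
  simp only [LinearMap.mem_ker, LinearMap.sub_apply, Module.End.one_apply, sub_eq_zero]
  constructor
  · intro hz p q h
    haveI := E.finite_obj hZ (2 * q)
    refine mem_map₂_top_of_forall_rTensor_eq (ι := Unit) (fun _ ↦ E.ρTwist X (2 * p) p g) _
      (fun v hv ↦ by
        rw [LinearMap.mem_ker, LinearMap.sub_apply, Module.End.one_apply, sub_eq_zero]
        exact hv ()) fun _ ↦ ?_
    have hcomp := LinearMap.congr_fun (E.kunnethComponent_comp_ρTwist hX hZ (by omega) (hZalg q) h g) z
    rw [LinearMap.comp_apply, LinearMap.comp_apply] at hcomp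
    rw [← hcomp]
    exact congrArg _ hz
  · intro hz
    conv_lhs => rw [← E.sum_extTensor_kunnethComponent hX hZ z]
    conv_rhs => rw [← E.sum_extTensor_kunnethComponent hX hZ z]
    rw [map_sum]
    refine Finset.sum_congr rfl fun ij _ ↦ ?_
    obtain ⟨⟨a, b⟩, hab⟩ := ij
    have hab' : a + b = 2 * c := mem_antidiagonal.mp hab
    rcases Nat.even_or_odd b with hb | hb
    · obtain ⟨q, rfl⟩ : ∃ q, b = 2 * q := ⟨b / 2, by have := Nat.even_iff.mp hb; omega⟩
      obtain ⟨p, rfl⟩ : ∃ p, a = 2 * p := ⟨c - q, by omega⟩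
      have hc : ((c : ℕ) : ℤ) = (p : ℤ) + (q : ℤ) := by omega
      dsimp only
      rw [hc, E.ρTwist_extTensor hX hZ _ p q g, E.ρTwist_eq_one_of_algebraicClasses_eq_top hZ (hZalg q) g,
        Module.End.one_eq_id]
      exact congrArg _ (rTensor_eq_self_of_mem_map₂ _
        (fun u hu ↦ by
          rw [LinearMap.mem_ker, LinearMap.sub_apply, Module.End.one_apply, sub_eq_zero] at hu
          exact hu) ⊤ (hz p q _))
    · dsimp only
      rw [E.kunnethComponent_eq_zero_of_odd_right hX hZ hZodd hb, map_zero, map_zero]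

/-- **The `(2p, 2q)` components of the `g`-fixed classes of `X × Z` fill `Ker(g − 1 | H^{2p}(X)(p)) ⊗ H^{2q}(Z)`.**
[cite: Milne2007TateFiniteFieldsAIM, Th. 1.3 (proof) and Cor. 2.2 (proof)] [cite: Tate1994, §1] -/
theorem map_kunnethComponent_ker_sub_one_tensor (hX : IsSmoothProjective n X) (hZ : IsSmoothProjective m Z)
    (hZalg : ∀ q, E.algebraicClasses Z q = ⊤) (hZodd : ∀ j, Odd j → Module.finrank K (E.obj Z j) = 0)
    (g : Field.absoluteGaloisGroup k) {p q c : ℕ} (h : 2 * p + 2 * q = 2 * c) :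
    (LinearMap.ker (E.ρTwist (X ⊗ Z) (2 * c) c g - 1)).map (E.kunnethComponent hX hZ (2 * p) (2 * q) h) =
      Submodule.map₂ (TensorProduct.mk K (E.obj X (2 * p)) (E.obj Z (2 * q)))
        (LinearMap.ker (E.ρTwist X (2 * p) p g - 1)) ⊤ := by
  refine le_antisymm ?_ fun t ht ↦ ?_
  · rintro _ ⟨z, hz, rfl⟩
    exact (E.mem_ker_sub_one_tensor_iff hX hZ hZalg hZodd g z).mp hz p q h
  · refine ⟨E.extTensor h t, (E.mem_ker_sub_one_tensor_iff hX hZ hZalg hZodd g _).mpr fun p' q' h' ↦ ?_,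
      E.kunnethComponent_extTensor_self hX hZ h t⟩
    by_cases hpq : (2 * p', 2 * q') = (2 * p, 2 * q)
    · obtain ⟨hp, hq⟩ := Prod.mk.inj hpq
      obtain rfl : p' = p := by omega
      obtain rfl : q' = q := by omega
      rw [E.kunnethComponent_extTensor_self hX hZ]
      exact ht
    · rw [E.kunnethComponent_extTensor_of_ne hX hZ h' h hpq]
      exact Submodule.zero_mem _

/-- **`dim Ker(g − 1 | H^{2c}(X × Z)(c)) = Σ_{p+q=c} dim Ker(g − 1 | H^{2p}(X)(p)) · b_{2q}(Z)`** for `Z` with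
fully algebraic cohomology (over `𝔽_q` with `g = φ`: Milne's `T(X,r)`-dimension of `X × Z` in terms of those of
`X`). [cite: Milne1986ValuesZetaFunctionsFiniteFields, §8 (T(X,r,ℓ), Prop. 8.2)] [cite: Milne2007TateFiniteFieldsAIM, Th. 1.3 (proof)]
[cite: Kahn2020, §3.6 axiom (vi)] -/
theorem finrank_ker_sub_one_tensor (hX : IsSmoothProjective n X) (hZ : IsSmoothProjective m Z)
    (hZalg : ∀ q, E.algebraicClasses Z q = ⊤) (hZodd : ∀ j, Odd j → Module.finrank K (E.obj Z j) = 0)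
    (g : Field.absoluteGaloisGroup k) (c : ℕ) :
    Module.finrank K (LinearMap.ker (E.ρTwist (X ⊗ Z) (2 * c) c g - 1)) =
      ∑ pq ∈ antidiagonal c, Module.finrank K (LinearMap.ker (E.ρTwist X (2 * pq.1) pq.1 g - 1)) *
        Module.finrank K (E.obj Z (2 * pq.2)) := by
  have heven : ∀ (p q : ℕ) (h : 2 * p + 2 * q = 2 * c),
      (LinearMap.ker (E.ρTwist (X ⊗ Z) (2 * c) c g - 1)).map (E.kunnethComponent hX hZ (2 * p) (2 * q) h) =
        Submodule.map₂ (TensorProduct.mk K (E.obj X (2 * p)) (E.obj Z (2 * q)))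
          (LinearMap.ker (E.ρTwist X (2 * p) p g - 1)) ⊤ :=
    fun p q h ↦ E.map_kunnethComponent_ker_sub_one_tensor hX hZ hZalg hZodd g h
  have hsat : ∀ z : E.obj (X ⊗ Z) (2 * c), (∀ (a b : ℕ) (h : a + b = 2 * c),
      E.kunnethComponent hX hZ a b h z ∈ (LinearMap.ker (E.ρTwist (X ⊗ Z) (2 * c) c g - 1)).map
        (E.kunnethComponent hX hZ a b h)) → z ∈ LinearMap.ker (E.ρTwist (X ⊗ Z) (2 * c) c g - 1) := by
    intro z hz
    refine (E.mem_ker_sub_one_tensor_iff hX hZ hZalg hZodd g z).mpr fun p q h ↦ ?_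
    rw [← heven p q h]
    exact hz _ _ h
  -- (elaborate the instance of the Künneth count first, then close the goal: unifying the summands against
  -- the expected type directly is expensive)
  have key := E.finrank_eq_sum_of_kunneth_pieces hX hZ hZodd (LinearMap.ker (E.ρTwist (X ⊗ Z) (2 * c) c g - 1))
    (fun p ↦ LinearMap.ker (E.ρTwist X (2 * p) p g - 1)) hsat heven
  exact key

/-! ### §3 The generalized eigenspace `H^{2c}(X × Z)(c)_1` and the semisimplicity condition `S` -/

/-- **`z ∈ H^{2c}(X × Z)(c)_1` (generalized eigenspace of `g` for the eigenvalue `1`) iff each Künneth component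
`z_{2p,2q}` lies in `H^{2p}(X)(p)_1 ⊗ H^{2q}(Z)`** (`Z` with fully algebraic cohomology): `((g − 1)^j z)_{2p,2q} =
((g − 1)^j ⊗ 1) z_{2p,2q}`, and `(g − 1)^N ⊗ 1` kills `H^{2p}(X)(p)_1 ⊗ H^{2q}(Z)` for `N ≥ b_{2p}(X)`.
[cite: Milne2007TateFiniteFieldsAIM, Th. 1.3 (proof: «H^r(X)_a ⊗ H^{2d−r}(X)(d)_{1/a} ⊂ H^{2d}(X × X)(d)_1»)]
[cite: Kahn2020, §6.14 (SS^i, Th. 6.54)] [cite: Roman2008, Ch. 14 Th. 14.6 (3)] -/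
theorem mem_maxGenEigenspace_one_tensor_iff (hX : IsSmoothProjective n X) (hZ : IsSmoothProjective m Z)
    (hZalg : ∀ q, E.algebraicClasses Z q = ⊤) (hZodd : ∀ j, Odd j → Module.finrank K (E.obj Z j) = 0)
    (g : Field.absoluteGaloisGroup k) {c : ℕ} (z : E.obj (X ⊗ Z) (2 * c)) :
    z ∈ Module.End.maxGenEigenspace (E.ρTwist (X ⊗ Z) (2 * c) c g) 1 ↔
      ∀ (p q : ℕ) (h : 2 * p + 2 * q = 2 * c), E.kunnethComponent hX hZ (2 * p) (2 * q) h z ∈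
        Submodule.map₂ (TensorProduct.mk K (E.obj X (2 * p)) (E.obj Z (2 * q)))
          (Module.End.maxGenEigenspace (E.ρTwist X (2 * p) p g) 1) ⊤ := by
  constructor
  · intro hz p q h
    rw [Module.End.mem_maxGenEigenspace] at hz
    obtain ⟨j, hj⟩ := hz
    rw [one_smul] at hj
    haveI := E.finite_obj hZ (2 * q)
    refine mem_map₂_top_of_forall_rid_lTensor_mem _ fun φ ↦ ?_
    rw [Module.End.mem_maxGenEigenspace]
    refine ⟨j, ?_⟩
    rw [one_smul, ← rid_lTensor_rTensor, ← E.kunnethComponent_ρTwist_sub_one_pow hX hZ (by omega) (hZalg q) h g j z,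
      hj, map_zero, map_zero, map_zero]
  · intro hz
    -- one exponent large enough for every piece
    haveI : ∀ p, Module.Finite K (E.obj X (2 * p)) := fun p ↦ E.finite_obj hX (2 * p)
    let N : ℕ := ∑ pq ∈ antidiagonal c, Module.finrank K (E.obj X (2 * pq.1))
    have hN : ∀ p q : ℕ, p + q = c → Module.finrank K (E.obj X (2 * p)) ≤ N := fun p q hpq ↦
      Finset.single_le_sum (f := fun pq : ℕ × ℕ ↦ Module.finrank K (E.obj X (2 * pq.1))) (fun _ _ ↦ Nat.zero_le _)
        (mem_antidiagonal.mpr hpq : (p, q) ∈ antidiagonal c)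
    rw [Module.End.mem_maxGenEigenspace]
    refine ⟨N, ?_⟩
    rw [one_smul]
    refine E.ext_kunnethComponent hX hZ fun a b hab ↦ ?_
    rw [map_zero]
    rcases Nat.even_or_odd b with hb | hb
    · obtain ⟨q, rfl⟩ : ∃ q, b = 2 * q := ⟨b / 2, by have := Nat.even_iff.mp hb; omega⟩
      obtain ⟨p, rfl⟩ : ∃ p, a = 2 * p := ⟨c - q, by omega⟩
      rw [E.kunnethComponent_ρTwist_sub_one_pow hX hZ (by omega) (hZalg q) hab g N z]
      refine rTensor_eq_zero_of_mem_map₂ _ (fun u hu ↦ ?_) ⊤ (hz p q hab)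
      -- `(g − 1)^N` kills `H^{2p}(X)(p)_1` since `N ≥ b_{2p}(X)`
      rw [Module.End.maxGenEigenspace_eq_genEigenspace_finrank, Module.End.mem_genEigenspace_nat, one_smul,
        LinearMap.mem_ker] at hu
      have hle : (Module.End.genEigenspace (E.ρTwist X (2 * p) p g) 1) (Module.finrank K (E.obj X (2 * p))) ≤
          (Module.End.genEigenspace (E.ρTwist X (2 * p) p g) 1) N :=
        (Module.End.genEigenspace (E.ρTwist X (2 * p) p g) 1).monotone (by exact_mod_cast hN p q (by omega))
      have hu' : u ∈ (Module.End.genEigenspace (E.ρTwist X (2 * p) p g) 1) N :=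
        hle (by rw [Module.End.mem_genEigenspace_nat, one_smul, LinearMap.mem_ker]; exact hu)
      rw [Module.End.mem_genEigenspace_nat, one_smul, LinearMap.mem_ker] at hu'
      exact hu'
    · exact E.kunnethComponent_eq_zero_of_odd_right hX hZ hZodd hb hab _

/-- **The `(2p, 2q)` components of `H^{2c}(X × Z)(c)_1` fill `H^{2p}(X)(p)_1 ⊗ H^{2q}(Z)`.**
[cite: Milne2007TateFiniteFieldsAIM, Th. 1.3 (proof)] [cite: Kahn2020, §6.14 (SS^i)] -/
theorem map_kunnethComponent_maxGenEigenspace_one_tensor (hX : IsSmoothProjective n X)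
    (hZ : IsSmoothProjective m Z) (hZalg : ∀ q, E.algebraicClasses Z q = ⊤)
    (hZodd : ∀ j, Odd j → Module.finrank K (E.obj Z j) = 0) (g : Field.absoluteGaloisGroup k) {p q c : ℕ}
    (h : 2 * p + 2 * q = 2 * c) :
    (Module.End.maxGenEigenspace (E.ρTwist (X ⊗ Z) (2 * c) c g) 1).map (E.kunnethComponent hX hZ (2 * p) (2 * q) h) =
      Submodule.map₂ (TensorProduct.mk K (E.obj X (2 * p)) (E.obj Z (2 * q)))
        (Module.End.maxGenEigenspace (E.ρTwist X (2 * p) p g) 1) ⊤ := by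
  refine le_antisymm ?_ fun t ht ↦ ?_
  · rintro _ ⟨z, hz, rfl⟩
    exact (E.mem_maxGenEigenspace_one_tensor_iff hX hZ hZalg hZodd g z).mp hz p q h
  · refine ⟨E.extTensor h t, (E.mem_maxGenEigenspace_one_tensor_iff hX hZ hZalg hZodd g _).mpr
      fun p' q' h' ↦ ?_, E.kunnethComponent_extTensor_self hX hZ h t⟩
    by_cases hpq : (2 * p', 2 * q') = (2 * p, 2 * q)
    · obtain ⟨hp, hq⟩ := Prod.mk.inj hpq
      obtain rfl : p' = p := by omega
      obtain rfl : q' = q := by omega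
      rw [E.kunnethComponent_extTensor_self hX hZ]
      exact ht
    · rw [E.kunnethComponent_extTensor_of_ne hX hZ h' h hpq]
      exact Submodule.zero_mem _

/-- **`dim H^{2c}(X × Z)(c)_1 = Σ_{p+q=c} dim H^{2p}(X)(p)_1 · b_{2q}(Z)`** (generalized eigenspaces of `g` for
the eigenvalue `1`; `Z` with fully algebraic cohomology). [cite: Milne2007TateFiniteFieldsAIM, Th. 1.2 and Th. 1.3 (proof)]
[cite: Kahn2020, §3.6 axiom (vi) and §6.14] -/
theorem finrank_maxGenEigenspace_one_tensor (hX : IsSmoothProjective n X) (hZ : IsSmoothProjective m Z)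
    (hZalg : ∀ q, E.algebraicClasses Z q = ⊤) (hZodd : ∀ j, Odd j → Module.finrank K (E.obj Z j) = 0)
    (g : Field.absoluteGaloisGroup k) (c : ℕ) :
    Module.finrank K (Module.End.maxGenEigenspace (E.ρTwist (X ⊗ Z) (2 * c) c g) 1) =
      ∑ pq ∈ antidiagonal c, Module.finrank K (Module.End.maxGenEigenspace (E.ρTwist X (2 * pq.1) pq.1 g) 1) *
        Module.finrank K (E.obj Z (2 * pq.2)) := by
  have heven : ∀ (p q : ℕ) (h : 2 * p + 2 * q = 2 * c),
      (Module.End.maxGenEigenspace (E.ρTwist (X ⊗ Z) (2 * c) c g) 1).map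
          (E.kunnethComponent hX hZ (2 * p) (2 * q) h) =
        Submodule.map₂ (TensorProduct.mk K (E.obj X (2 * p)) (E.obj Z (2 * q)))
          (Module.End.maxGenEigenspace (E.ρTwist X (2 * p) p g) 1) ⊤ :=
    fun p q h ↦ E.map_kunnethComponent_maxGenEigenspace_one_tensor hX hZ hZalg hZodd g h
  have hsat : ∀ z : E.obj (X ⊗ Z) (2 * c), (∀ (a b : ℕ) (h : a + b = 2 * c),
      E.kunnethComponent hX hZ a b h z ∈ (Module.End.maxGenEigenspace (E.ρTwist (X ⊗ Z) (2 * c) c g) 1).map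
        (E.kunnethComponent hX hZ a b h)) → z ∈ Module.End.maxGenEigenspace (E.ρTwist (X ⊗ Z) (2 * c) c g) 1 := by
    intro z hz
    refine (E.mem_maxGenEigenspace_one_tensor_iff hX hZ hZalg hZodd g z).mpr fun p q h ↦ ?_
    rw [← heven p q h]
    exact hz _ _ h
  have key := E.finrank_eq_sum_of_kunneth_pieces hX hZ hZodd
    (Module.End.maxGenEigenspace (E.ρTwist (X ⊗ Z) (2 * c) c g) 1)
    (fun p ↦ Module.End.maxGenEigenspace (E.ρTwist X (2 * p) p g) 1) hsat heven
  exact key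

/-- **The semisimplicity condition `S` transfers: `1` is a semisimple eigenvalue of `g` on `H^{2c}(X × Z)(c)`
(`Ker(g − 1) ∩ (g − 1)H = 0`) iff it is one on `H^{2p}(X)(p)` for every `p + q = c` with `H^{2q}(Z) ≠ 0`**, for
`Z` with fully algebraic cohomology — both fixed spaces and generalized eigenspaces decompose along the Künneth
pieces with the same multiplicities `b_{2q}(Z)`. [cite: Milne2007TateFiniteFieldsAIM, §1 Conjecture S^r(X, ℓ) and Th. 1.3]
[cite: Kahn2020, §6.14 (S^i, Th. 6.54)] [cite: Milne1986ValuesZetaFunctionsFiniteFields, §8 (SS)] -/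
theorem ker_inf_range_eq_bot_tensor_iff (hX : IsSmoothProjective n X) (hZ : IsSmoothProjective m Z)
    (hZalg : ∀ q, E.algebraicClasses Z q = ⊤) (hZodd : ∀ j, Odd j → Module.finrank K (E.obj Z j) = 0)
    (g : Field.absoluteGaloisGroup k) (c : ℕ) :
    LinearMap.ker (E.ρTwist (X ⊗ Z) (2 * c) c g - 1) ⊓ LinearMap.range (E.ρTwist (X ⊗ Z) (2 * c) c g - 1) = ⊥ ↔
      ∀ p q : ℕ, p + q = c → Nontrivial (E.obj Z (2 * q)) →
        LinearMap.ker (E.ρTwist X (2 * p) p g - 1) ⊓ LinearMap.range (E.ρTwist X (2 * p) p g - 1) = ⊥ := by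
  rw [Literature.LinearAlgebra.InvariantPairing.ker_inf_range_eq_bot_iff_maxGenEigenspace_eq]
  constructor
  · intro hS p q hpq hq
    rw [Literature.LinearAlgebra.InvariantPairing.ker_inf_range_eq_bot_iff_maxGenEigenspace_eq]
    have h : 2 * p + 2 * q = 2 * c := by omega
    haveI := hq
    refine le_antisymm (le_of_map₂_top_le_map₂_top (W := E.obj Z (2 * q)) ?_) fun v hv ↦
      (Module.End.mem_maxGenEigenspace _ _ _).mpr ⟨1, by rwa [pow_one, one_smul, ← LinearMap.mem_ker]⟩
    rw [← E.map_kunnethComponent_maxGenEigenspace_one_tensor hX hZ hZalg hZodd g h, hS,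
      E.map_kunnethComponent_ker_sub_one_tensor hX hZ hZalg hZodd g h]
  · intro hS
    ext z
    rw [E.mem_maxGenEigenspace_one_tensor_iff hX hZ hZalg hZodd g, E.mem_ker_sub_one_tensor_iff hX hZ hZalg hZodd g]
    refine forall_congr' fun p ↦ forall_congr' fun q ↦ forall_congr' fun h ↦ ?_
    rcases subsingleton_or_nontrivial (E.obj Z (2 * q)) with hq | hq
    · rw [eq_zero_of_subsingleton_right (E.kunnethComponent hX hZ (2 * p) (2 * q) h z)]
      exact ⟨fun _ ↦ Submodule.zero_mem _, fun _ ↦ Submodule.zero_mem _⟩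
    · rw [(Literature.LinearAlgebra.InvariantPairing.ker_inf_range_eq_bot_iff_maxGenEigenspace_eq _).mp (hS p q (by omega) hq)]

/-! ### §4 Finite field: the order of the pole of `Z(X × Z, T)` at `T = q^{−c}` -/

section FiniteField

variable [Finite k]

/-- **`ord_{T = q^{−c}} Z(X × Z, T) = Σ_{p+q=c} dim H^{2p}(X)(p)_1 · b_{2q}(Z)`** for `Z` with fully algebraic
cohomology, in `E` with the Lefschetz trace formula and `χ(φ_arith) = q`, granted the Riemann hypothesis for `X`
and for `Z` (hence for `X × Z`): the pole order is `dim H^{2c}(X × Z)(c)_1` (the tree's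
`hasPoleOfOrderAt_zetaSeries`), decomposed by `finrank_maxGenEigenspace_one_tensor` with `g` the geometric Frobenius.
Row g52-#11 is the case `Z = 𝐏ⁿ`. [cite: TateWoodsHole1965, §3 (12)–(13)] [cite: Milne2007TateFiniteFieldsAIM, Th. 1.2]
[cite: Kahn2020, §6.14 Conj. 6.52 and Th. 6.53] -/
theorem hasPoleOfOrderAt_zetaSeries_tensor_of_algebraic_cohomology (hE : E.HasLefschetzTraceFormula)
    (hχ : ((χ (arithFrob k) : Kˣ) : K) = Nat.card k) (hX : IsSmoothProjective n X) (hZ : IsSmoothProjective m Z)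
    (hZalg : ∀ q, E.algebraicClasses Z q = ⊤) (hZodd : ∀ j, Odd j → Module.finrank K (E.obj Z j) = 0)
    (hRHX : E.WeilRiemannHypothesisFor X n) (hRHZ : E.WeilRiemannHypothesisFor Z m) {c : ℕ} (hc : c ≤ n + m) :
    HasPoleOfOrderAt (zetaSeries (X ⊗ Z)) (((Nat.card k : ℚ) ^ c)⁻¹)
      (∑ pq ∈ antidiagonal c,
        Module.finrank K (Module.End.maxGenEigenspace (E.ρTwist X (2 * pq.1) pq.1 (geomFrob k)) 1) *
          Module.finrank K (E.obj Z (2 * pq.2))) := by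
  rw [← E.finrank_maxGenEigenspace_one_tensor hX hZ hZalg hZodd (geomFrob k) c]
  exact E.hasPoleOfOrderAt_zetaSeries hE hχ (IsSmoothProjective.tensor_holds hX hZ)
    (E.weilRiemannHypothesisFor_tensor hX hZ hRHX hRHZ) hc

/-- **`ord_{q^{−c}} Z(X × Z, T) = Σ_{p+q=c} ord_{q^{−p}} Z(X, T) · b_{2q}(Z)`**: if `Z(X, T)` has a pole of order
`ν_p` at `q^{−p}` for each `p ≤ n` and `ν_p = 0` for `p > n`, then `Z(X × Z, T)` has a pole of order
`Σ_{p+q=c} ν_p · b_{2q}(Z)` at `q^{−c}` (`c ≤ n + m`; `Z` with fully algebraic cohomology, RH for `X`, `Z`).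
[cite: TateWoodsHole1965, §3 (12)–(13)] [cite: Milne2007TateFiniteFieldsAIM, Th. 1.2] [cite: Kahn2020, §6.14] -/
theorem hasPoleOfOrderAt_zetaSeries_tensor_of_forall (hE : E.HasLefschetzTraceFormula)
    (hχ : ((χ (arithFrob k) : Kˣ) : K) = Nat.card k) (hX : IsSmoothProjective n X) (hZ : IsSmoothProjective m Z)
    (hZalg : ∀ q, E.algebraicClasses Z q = ⊤) (hZodd : ∀ j, Odd j → Module.finrank K (E.obj Z j) = 0)
    (hRHX : E.WeilRiemannHypothesisFor X n) (hRHZ : E.WeilRiemannHypothesisFor Z m) {ν : ℕ → ℕ}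
    (hν : ∀ p ≤ n, HasPoleOfOrderAt (zetaSeries X) (((Nat.card k : ℚ) ^ p)⁻¹) (ν p))
    (hν' : ∀ p, n < p → ν p = 0) {c : ℕ} (hc : c ≤ n + m) :
    HasPoleOfOrderAt (zetaSeries (X ⊗ Z)) (((Nat.card k : ℚ) ^ c)⁻¹)
      (∑ pq ∈ antidiagonal c, ν pq.1 * Module.finrank K (E.obj Z (2 * pq.2))) := by
  have key := E.hasPoleOfOrderAt_zetaSeries_tensor_of_algebraic_cohomology hE hχ hX hZ hZalg hZodd hRHX hRHZ hc
  have hsum : (∑ pq ∈ antidiagonal c,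
      Module.finrank K (Module.End.maxGenEigenspace (E.ρTwist X (2 * pq.1) pq.1 (geomFrob k)) 1) *
        Module.finrank K (E.obj Z (2 * pq.2))) =
      ∑ pq ∈ antidiagonal c, ν pq.1 * Module.finrank K (E.obj Z (2 * pq.2)) := by
    refine Finset.sum_congr rfl fun pq _ ↦ ?_
    rcases Nat.lt_or_ge n pq.1 with hp | hp
    · haveI := E.subsingleton_obj hX (i := 2 * pq.1) (by omega)
      have h0 : Module.finrank K (Module.End.maxGenEigenspace (E.ρTwist X (2 * pq.1) pq.1 (geomFrob k)) 1) = 0 :=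
        Module.finrank_zero_of_subsingleton
      rw [h0, hν' pq.1 hp]
    · rw [(E.hasPoleOfOrderAt_zetaSeries hE hχ hX hRHX hp).unique (hν pq.1 hp)]
  rwa [hsum] at key

end FiniteField

end GaloisWeilCohomology

end Literature.AlgebraicGeometry.Motives

end
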